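import Mathlib
import HarnessLib
import Summits.HubbardSuperconductivity.HubbardSuperconductivity.Theorems.KLProgrammeKLRegimeEnginePairLadderTowerShapedMap

/-!
# Route `KLProgramme` — crux K3, ENGINE child (gen 6 stmt-…-20236 `KLRegimeEngineV16`; gen 7-flow twin at K := K_n), stub `stub_engine_step_values`,
# conjunct (E2-v10) at `1 ≤ n`: the INNER level of the scale-flow door on shaped majorants — `kltc_wickMajorant_shaped`

Cell gate-hubbard-kl, seat hubbard-kl-k3c1-p1 (g7), technique «composed-map remainder propagation».  The Wick-step majorant `E_a(k,k′)` that the doors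
`pairLadderStepAtV10_of_scaleFlow_dressed` (p523369) / `kltc_wickStep_of_flow_conjugated` (p522267) ask for is, at an external entry `(x,y)` of the product
carrier `T = S × F`:
`e(x,y)·FT_{ρ̃}(I)(x,y) + (e(x,y) − 1)·(3/2)m + [p_L Σ_c L(x,c)w_c + q_L Σ_a w_a L(a,y) + r_L Σ_aΣ_c w_a L(a,c) w_c]`
(`I` = the conjugated source integral, `L` = the frequency-localisation error, `w = ‖W‖ ≤ ρ̃` the dressed step weight, `e(x,y) = e^{‖α₁x‖+‖γ₁y‖}`).  If `I` and `L`
are SHAPED through the momentum projection `π : T → S` (`≤ u + l_R λ(πx) + l_C λ(πy) + c(φ(πx−πy) + φ(πx+πy−Q))`), the weight `ρ̃` has mass / leg mass /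
angular mass `(Z, Λ, ε)`, and the dressing factor obeys `1 ≤ e ≤ e_A`, `e − 1 ≤ e_A·(a_R λ(πx) + a_C λ(πy))` (legs dressed only on the window), then the
whole majorant is again a shape in `(πx, πy)` with explicit coefficients (`kltc_fourTerm_shaped_le_map` twice, p524846) — the `E_a`-shape input of
`kltc_tower_budget_shaped_fwd` (…TowerShapedFwd).  (For the dressing hypothesis use `e^s − 1 ≤ s·e^s`, in the tree as
`Literature.Analysis.ODE.OneSidedComparison`'s `exp_sub_one_le_mul_exp`, with `s ≤ 2A`.)

Arithmetic only; nothing about the model is asserted.  0 kit.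
-/

noncomputable section

namespace Summit.HubbardSuperconductivity.HubbardSuperconductivity.Theorems.KLRegimeSplit

set_option linter.dupNamespace false -- summit = problem name (single-conjunct summit), D-0017

open Finset

section ShapedInner

variable {T S : Type*} [Fintype T] [AddCommGroup S]

set_option maxHeartbeats 400000 in -- two shaped levels + linear bookkeeping
/-- **The Wick-step majorant on shaped inputs (inner level of the scale-flow door).**  See the module docstring; `p, q, r` (source four-term) and
`p_L, q_L, r_L` (localisation) are free nonnegative coefficients (the doors use `p = (3/2)(3/2m̃)`, `q = (3/2)m̃`, `r = (9/4)m̃(3/2m̃)`, `p_L = q_L = (3/2)m`,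
`r_L = (9/4)m²`). -/
theorem kltc_wickMajorant_shaped (π : T → S) (I L : T → T → ℝ) (ρt w : T → ℝ) (lam φ : S → ℝ) (Q : S)
    {m ex eA aR aC uI lIR lIC cI uL lLR lLC cL p q r pL qL rL Z Λ ε : ℝ}
    (hm : 0 ≤ m) (huI : 0 ≤ uI) (hlIR : 0 ≤ lIR) (hlIC : 0 ≤ lIC) (hcI : 0 ≤ cI) (huL : 0 ≤ uL) (hlLR : 0 ≤ lLR) (hlLC : 0 ≤ lLC)
    (hcL : 0 ≤ cL) (hp : 0 ≤ p) (hq : 0 ≤ q) (hr : 0 ≤ r) (hpL : 0 ≤ pL) (hqL : 0 ≤ qL) (hrL : 0 ≤ rL)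
    (hρt : ∀ a, 0 ≤ ρt a) (hw0 : ∀ a, 0 ≤ w a) (hw : ∀ a, w a ≤ ρt a) (hlam : ∀ a, 0 ≤ lam a) (hφ0 : ∀ v, 0 ≤ φ v)
    (hφ : ∀ v, φ (-v) = φ v)
    (hI0 : ∀ x y, 0 ≤ I x y)
    (hI : ∀ x y, I x y ≤ uI + lIR * lam (π x) + lIC * lam (π y) + cI * (φ (π x - π y) + φ (π x + π y - Q)))
    (hL0 : ∀ x y, 0 ≤ L x y)
    (hL : ∀ x y, L x y ≤ uL + lLR * lam (π x) + lLC * lam (π y) + cL * (φ (π x - π y) + φ (π x + π y - Q)))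
    (hZ : ∑ a, ρt a ≤ Z) (hΛ : ∑ a, ρt a * lam (π a) ≤ Λ) (hang : ∀ c₀ : S, ∑ b, ρt b * φ (π b - c₀) ≤ ε)
    (x y : T) (he1 : 1 ≤ ex) (heA : ex ≤ eA) (hes : ex - 1 ≤ eA * (aR * lam (π x) + aC * lam (π y))) :
    ex * (I x y + p * ∑ b, I x b * ρt b + q * ∑ a, ρt a * I a y + r * ∑ a, ∑ b, ρt a * I a b * ρt b) + (ex - 1) * (3 / 2 * m) +
        (pL * ∑ b, L x b * w b + qL * ∑ a, w a * L a y + rL * ∑ a, ∑ b, w a * L a b * w b) ≤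
      (eA * (uI * (1 + p * Z + q * Z + r * Z * Z) + p * (lIC * Λ) + q * (lIR * Λ) + r * Z * (lIR * Λ + lIC * Λ) + 2 * cI * ε * (p + q + r * Z)) +
          (uL * (1 + pL * Z + qL * Z + rL * Z * Z) + pL * (lLC * Λ) + qL * (lLR * Λ) + rL * Z * (lLR * Λ + lLC * Λ) +
            2 * cL * ε * (pL + qL + rL * Z))) +
        (eA * ((1 + p * Z) * lIR) + (1 + pL * Z) * lLR + eA * aR * (3 / 2 * m)) * lam (π x) +
        (eA * ((1 + q * Z) * lIC) + (1 + qL * Z) * lLC + eA * aC * (3 / 2 * m)) * lam (π y) +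
        (eA * cI + cL) * (φ (π x - π y) + φ (π x + π y - Q)) := by
  have hZ0 : 0 ≤ Z := (sum_nonneg fun a _ => hρt a).trans hZ
  have hΛ0 : 0 ≤ Λ := (sum_nonneg fun a _ => mul_nonneg (hρt a) (hlam _)).trans hΛ
  have hε0 : 0 ≤ ε := (sum_nonneg fun b _ => mul_nonneg (hρt b) (hφ0 _)).trans (hang (π x))
  have heA0 : 0 ≤ eA := zero_le_one.trans (he1.trans heA)
  -- level I: the source four-term, weights `ρ̃`
  have h1 := kltc_fourTerm_shaped_le_map π I ρt (fun s => lIR * lam s) (fun s => lIC * lam s) φ Q huI hcI hp hq hr hρt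
    (fun s => mul_nonneg hlIR (hlam s)) (fun s => mul_nonneg hlIC (hlam s)) hφ0 hφ hI hZ
    (by calc ∑ a, ρt a * (lIR * lam (π a)) = lIR * ∑ a, ρt a * lam (π a) := by rw [mul_sum]; exact sum_congr rfl fun a _ => by ring
          _ ≤ lIR * Λ := mul_le_mul_of_nonneg_left hΛ hlIR)
    (by calc ∑ a, ρt a * (lIC * lam (π a)) = lIC * ∑ a, ρt a * lam (π a) := by rw [mul_sum]; exact sum_congr rfl fun a _ => by ring
          _ ≤ lIC * Λ := mul_le_mul_of_nonneg_left hΛ hlIC)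
    hang x y
  -- masses of `w ≤ ρ̃`
  have hZw : ∑ a, w a ≤ Z := (sum_le_sum fun a _ => hw a).trans hZ
  have hΛw : ∑ a, w a * (lLR * lam (π a)) ≤ lLR * Λ := by
    calc ∑ a, w a * (lLR * lam (π a)) ≤ ∑ a, ρt a * (lLR * lam (π a)) :=
          sum_le_sum fun a _ => mul_le_mul_of_nonneg_right (hw a) (mul_nonneg hlLR (hlam _))
      _ = lLR * ∑ a, ρt a * lam (π a) := by rw [mul_sum]; exact sum_congr rfl fun a _ => by ring
      _ ≤ lLR * Λ := mul_le_mul_of_nonneg_left hΛ hlLR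
  have hΛw' : ∑ a, w a * (lLC * lam (π a)) ≤ lLC * Λ := by
    calc ∑ a, w a * (lLC * lam (π a)) ≤ ∑ a, ρt a * (lLC * lam (π a)) :=
          sum_le_sum fun a _ => mul_le_mul_of_nonneg_right (hw a) (mul_nonneg hlLC (hlam _))
      _ = lLC * ∑ a, ρt a * lam (π a) := by rw [mul_sum]; exact sum_congr rfl fun a _ => by ring
      _ ≤ lLC * Λ := mul_le_mul_of_nonneg_left hΛ hlLC
  have hangw : ∀ c₀ : S, ∑ b, w b * φ (π b - c₀) ≤ ε := fun c₀ =>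
    (sum_le_sum fun b _ => mul_le_mul_of_nonneg_right (hw b) (hφ0 _)).trans (hang c₀)
  -- level L: the localisation four-term, weights `w`
  have h2 := kltc_fourTerm_shaped_le_map π L w (fun s => lLR * lam s) (fun s => lLC * lam s) φ Q huL hcL hpL hqL hrL hw0
    (fun s => mul_nonneg hlLR (hlam s)) (fun s => mul_nonneg hlLC (hlam s)) hφ0 hφ hL hZw hΛw hΛw' hangw x y
  -- the source level is multiplied by `ex ≤ eA`
  have hFT0 : 0 ≤ I x y + p * ∑ b, I x b * ρt b + q * ∑ a, ρt a * I a y + r * ∑ a, ∑ b, ρt a * I a b * ρt b := by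
    have s1 : 0 ≤ ∑ b, I x b * ρt b := sum_nonneg fun b _ => mul_nonneg (hI0 x b) (hρt b)
    have s2 : 0 ≤ ∑ a, ρt a * I a y := sum_nonneg fun a _ => mul_nonneg (hρt a) (hI0 a y)
    have s3 : 0 ≤ ∑ a, ∑ b, ρt a * I a b * ρt b :=
      sum_nonneg fun a _ => sum_nonneg fun b _ => mul_nonneg (mul_nonneg (hρt a) (hI0 a b)) (hρt b)
    have := hI0 x y
    positivity
  have e1 : ex * (I x y + p * ∑ b, I x b * ρt b + q * ∑ a, ρt a * I a y + r * ∑ a, ∑ b, ρt a * I a b * ρt b) ≤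
      eA * (uI * (1 + p * Z + q * Z + r * Z * Z) + p * (lIC * Λ) + q * (lIR * Λ) + r * Z * (lIR * Λ + lIC * Λ) + 2 * cI * ε * (p + q + r * Z)) +
        eA * ((1 + p * Z) * lIR) * lam (π x) + eA * ((1 + q * Z) * lIC) * lam (π y) + eA * cI * (φ (π x - π y) + φ (π x + π y - Q)) := by
    calc ex * (I x y + p * ∑ b, I x b * ρt b + q * ∑ a, ρt a * I a y + r * ∑ a, ∑ b, ρt a * I a b * ρt b)
        ≤ eA * (I x y + p * ∑ b, I x b * ρt b + q * ∑ a, ρt a * I a y + r * ∑ a, ∑ b, ρt a * I a b * ρt b) :=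
          mul_le_mul_of_nonneg_right heA hFT0
      _ ≤ eA * ((uI * (1 + p * Z + q * Z + r * Z * Z) + p * (lIC * Λ) + q * (lIR * Λ) + r * Z * (lIR * Λ + lIC * Λ) +
            2 * cI * ε * (p + q + r * Z)) + (1 + p * Z) * (lIR * lam (π x)) + (1 + q * Z) * (lIC * lam (π y)) +
            cI * (φ (π x - π y) + φ (π x + π y - Q))) := mul_le_mul_of_nonneg_left h1 heA0
      _ = _ := by ring
  -- the external dressing term
  have e3 : (ex - 1) * (3 / 2 * m) ≤ eA * aR * (3 / 2 * m) * lam (π x) + eA * aC * (3 / 2 * m) * lam (π y) := by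
    have h := mul_le_mul_of_nonneg_right hes (by positivity : (0 : ℝ) ≤ 3 / 2 * m)
    have heq : eA * (aR * lam (π x) + aC * lam (π y)) * (3 / 2 * m) =
        eA * aR * (3 / 2 * m) * lam (π x) + eA * aC * (3 / 2 * m) * lam (π y) := by ring
    linarith [h, heq.le, heq.ge]
  -- the localisation level without its (nonnegative) head
  have e4 : pL * ∑ b, L x b * w b + qL * ∑ a, w a * L a y + rL * ∑ a, ∑ b, w a * L a b * w b ≤
      (uL * (1 + pL * Z + qL * Z + rL * Z * Z) + pL * (lLC * Λ) + qL * (lLR * Λ) + rL * Z * (lLR * Λ + lLC * Λ) +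
          2 * cL * ε * (pL + qL + rL * Z)) + (1 + pL * Z) * (lLR * lam (π x)) + (1 + qL * Z) * (lLC * lam (π y)) +
        cL * (φ (π x - π y) + φ (π x + π y - Q)) := by
    linarith [h2, hL0 x y]
  linarith [e1, e3, e4]

end ShapedInner

end Summit.HubbardSuperconductivity.HubbardSuperconductivity.Theorems.KLRegimeSplit

end
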